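import Summits.AtomisticToContinuum.HydrodynamicLimit.Theses.BGEndpointRigidity
import Summits.AtomisticToContinuum.HydrodynamicLimit.Theorems.InformationPercolationEngineCollisionRateLanfordEnvelopeInitial

/-!
# Birth skeleton of the crux `LanfordEnvelopeR` (stmt-AtomisticToContinuum-13677)

Route `route-AtomisticToContinuum-BGEndpointRigidity`, crux decl
`Summit.AtomisticToContinuum.HydrodynamicLimit.Theses.BGEndpointRigidity.LanfordEnvelopeR` — the N-uniform
Lanford (Gaussian) envelope `|f^{(s)}_{N+1}(t)| ≤ C^s e^{-β E(Z_s)}`, a.e. `Z_s`, of ALL volume-marginals of the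
evolved local Gibbs law `𝟙_{D_ε} · (W_N ∘ Φ_{-t})` at FIXED reduced density `σ < σ₀`, uniformly on `[0, T]`.
Skeleton registrar `planner-skel-stmt-AtomisticToContinuum-13677-0`, 2026-08-17 (BC3 birth certificate of the crux;
re-audit bin REPAIRABLE). The cut follows the delimiters recorded on the item itself ("t = 0, all s, and all t for
s ≥ α(N+1) follow from domination + energy conservation + the insertion bound; the content is s = o(N) at t > 0"):

* **time zero is LANDED, not a stub**: `Theorems.CollisionRate.stub_lanfordEnvelopeR_initial`
  (`Theorems/InformationPercolationEngineCollisionRateLanfordEnvelopeInitial.lean`, sorry-free; GST 2013 Prop. 6.1.2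
  first step in the dilution regime `8σ³C' ≤ 1/2`) gives `σ₀(profiles)` and, for `σ < σ₀`, constants `(β₀, C₀)` with
  the envelope at `t = 0` for every `N`, every flow and every order `s`; the composition below invokes it BY NAME.
* `stub_crudeEnvelope` (S1, energy conservation + Liouville + Tonelli; size M, provable now): from the time-zero
  envelope — whose order `s = N + 1` is an a.e. POINTWISE Gaussian bound `W_N ≤ C₀^{N+1} e^{-β₀ E}` on `D_ε`
  (`nthMarginal_self_apply`, `Φ_0 = id` on `good`) — conservation of `E` along every good orbit
  (`IsHardSphereTrajectory.configEnergy_eq_holds`), invariance of the Liouville measure under `Φ_{-t}`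
  (`HardSphereFlow.measurePreserving`, so the a.e. bound is transported) and `vol(D ∖ good) = 0` give
  `𝟙_D · (W_N ∘ Φ_{-t}) ≤ C₀^{N+1} e^{-β₀ E}` a.e. for EVERY `t`; integrating out `N + 1 - s` particles (Tonelli along
  `Fin.append`; `∫_{𝕋³×ℝ³} e^{-β₀|v|²/2} = (2π/β₀)^{3/2} =: I`) yields the CRUDE all-time envelope
  `|f^{(s)}(t)| ≤ K^{N+1} C^s e^{-β₀ E(Z_s)}`, `K = max 1 (C₀ I)`, `C = C₀` — the "only N-uniform a-priori bound, off
  by `e^{cN}` at small `s`" of the crux's why-line, made a lemma. It is exactly what closes the BULK orders.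
* `stub_coreEnvelope` (S2, THE HEART; size XL = the crux's open content): in the dilute regime `σ < σ₀'(profiles)`,
  given the time-zero envelope `(β₀, C₀)` and the crude all-time envelope `(β₀, K, C₁)`, for every horizon `T > 0`
  there are a core fraction `1/m` and constants `(β, C)` with the GENUINE envelope `|f^{(s)}(t)| ≤ C^s e^{-β E(Z_s)}`
  for the CORE orders `m·s < N + 1` and `t ∈ [0, T]` — Lanford's bound iterated over `≍ T (N+1)^{1/3}` kinetic windows
  WITHOUT loss of the constants (Duhamel pruning along the evolved law, the time-zero data restarting each window and
  the crude envelope bounding the truncated tails). This is where the HighMomentumCutoff-type risk of the crux lives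
  (collisional concentration of energy on few particles before `T`).
* Composition `LanfordEnvelopeR_of : S1 → S2 → LanfordEnvelopeR` (sorry-free; real content: `σ₀ := min σ₀ᴱ⁰ σ₀'`,
  the landed time-zero theorem feeding both stubs, and the MERGE of the two regimes — for `m·s < N + 1` the core
  envelope, for `N + 1 ≤ m·s` the crude one with the exponential-in-`N` factor ABSORBED into the order,
  `K^{N+1} ≤ K^{m s} = (K^m)^s` (`1 ≤ K`), under the common constants `β := min β₀ β₂`, `C := max (K^m C₁) |C₂|`,
  using `0 ≤ E(Z_s)`), and `LanfordEnvelopeR_skeleton` = the crux modulo the two sorries.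

Disproof used: none exists for this crux at registration (`ledger crux ls stmt-AtomisticToContinuum-13677`: no
workfiles). Negatives index / refutation record honoured: the refuted predecessor `LanfordEnvelope` (stmt-11470,
`Theorems.BGEndpointRigidityLanfordEnvelope_refuted`: flow junk off `good` integrated by a volume-marginal) is
answered in every formula below exactly as in the repaired crux — the transported density is cut by the indicator of
`hardSphereDomain` INSIDE `nthMarginal` (`evolvedMarginal`), so junk lives on the volume-null `D ∖ good`.
-/

noncomputable section

open MeasureTheory Filter Set
open scoped ENNReal Topology

namespace Summit.AtomisticToContinuum.HydrodynamicLimit.Cruxes.LanfordEnvelopeR.Birth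

open Literature.MathematicalPhysics.KineticTheory Literature.Analysis.FluidPDE
open Summit.AtomisticToContinuum.HydrodynamicLimit.Theses

/-! ## §0 Objects of the line -/

/-- The time-zero local Gibbs density of `N + 1` hard spheres of reduced diameter `σ` (diameter
`ε_N = σ (N+1)^{-1/3}`) with profiles `(a₀, u₀, θ₀)`: `W_N = 𝒵⁻¹ 𝟙_{D_ε} (a₀ M_{1,u₀,θ₀})^{⊗(N+1)}` — verbatim the
density inside the crux. -/
def gibbsDensity (σ : ℝ) (a₀ : T3 → ℝ) (u₀ : T3 → V3) (θ₀ : T3 → ℝ) (N : ℕ) :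
    Config (N + 1) (Fin 3) T3 → ℝ :=
  canonicalDensity (Literature.Analysis.FluidPDE.Torus.geometry (Fin 3)) (hsDiameter σ N) (N + 1)
    (localGibbsProfile a₀ u₀ θ₀)

/-- The `s`-particle volume-marginal of the evolved, domain-cut local Gibbs density at time `t`:
`f^{(s)}_{N+1}(t) = ∫ 𝟙_{D_ε} (W_N ∘ Φ_{-t}) dz_{s+1} ⋯ dz_{N+1}` — verbatim the function bounded in the crux
(indicator of `hardSphereDomain` INSIDE `nthMarginal`, the repair of stmt-11470). -/
def evolvedMarginal (σ : ℝ) (a₀ : T3 → ℝ) (u₀ : T3 → V3) (θ₀ : T3 → ℝ) (N : ℕ)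
    (Φ : HardSphereFlow (Literature.Analysis.FluidPDE.Torus.geometry (Fin 3)) (hsDiameter σ N) (N + 1))
    (t : ℝ) (s : ℕ) : Config s (Fin 3) T3 → ℝ :=
  nthMarginal (N + 1) s
    ((hardSphereDomain (Literature.Analysis.FluidPDE.Torus.geometry (Fin 3)) (N + 1) (hsDiameter σ N)).indicator
      (hsTransport Φ t (gibbsDensity σ a₀ u₀ θ₀ N)))

/-- **Time-zero envelope with constants `(β₀, C₀)`** — verbatim the conclusion of the landed
`Theorems.CollisionRate.stub_lanfordEnvelopeR_initial` at reduced diameter `σ`: for every `N`, every flow and every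
order `s`, a.e. `|f^{(s)}_{N+1}(0)| ≤ C₀^s e^{-β₀ E(Z_s)}`. -/
def TimeZeroEnvelope (σ : ℝ) (a₀ : T3 → ℝ) (u₀ : T3 → V3) (θ₀ : T3 → ℝ) (β₀ C₀ : ℝ) : Prop :=
  ∀ (N : ℕ) (Φ : HardSphereFlow (Literature.Analysis.FluidPDE.Torus.geometry (Fin 3)) (hsDiameter σ N) (N + 1))
    (s : ℕ), ∀ᵐ Zs : Config s (Fin 3) T3,
      |evolvedMarginal σ a₀ u₀ θ₀ N Φ 0 s Zs| ≤ C₀ ^ s * Real.exp (-(β₀ * configEnergy Zs))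

/-- **Crude all-time envelope with constants `(β, K, C)`**: for every `N`, every flow, every order `s` and EVERY time
`t`, a.e. `|f^{(s)}_{N+1}(t)| ≤ K^{N+1} C^s e^{-β E(Z_s)}` — the a-priori bound with the exponential-in-`N` loss. -/
def CrudeEnvelope (σ : ℝ) (a₀ : T3 → ℝ) (u₀ : T3 → V3) (θ₀ : T3 → ℝ) (β K C : ℝ) : Prop :=
  ∀ (N : ℕ) (Φ : HardSphereFlow (Literature.Analysis.FluidPDE.Torus.geometry (Fin 3)) (hsDiameter σ N) (N + 1))
    (s : ℕ) (t : ℝ), ∀ᵐ Zs : Config s (Fin 3) T3,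
      |evolvedMarginal σ a₀ u₀ θ₀ N Φ t s Zs| ≤ K ^ (N + 1) * C ^ s * Real.exp (-(β * configEnergy Zs))

/-- **Core envelope on `[0, T]` with core fraction `1/m` and constants `(β, C)`**: for every `N`, every flow and the
CORE orders `m·s < N + 1`, for `t ∈ [0, T]`, a.e. `|f^{(s)}_{N+1}(t)| ≤ C^s e^{-β E(Z_s)}` (no loss in `N`). -/
def CoreEnvelopeOn (σ : ℝ) (a₀ : T3 → ℝ) (u₀ : T3 → V3) (θ₀ : T3 → ℝ) (T : ℝ) (m : ℕ) (β C : ℝ) : Prop :=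
  ∀ (N : ℕ) (Φ : HardSphereFlow (Literature.Analysis.FluidPDE.Torus.geometry (Fin 3)) (hsDiameter σ N) (N + 1))
    (s : ℕ), m * s < N + 1 → ∀ t ∈ Icc 0 T, ∀ᵐ Zs : Config s (Fin 3) T3,
      |evolvedMarginal σ a₀ u₀ θ₀ N Φ t s Zs| ≤ C ^ s * Real.exp (-(β * configEnergy Zs))

/-! ## §1 Stub signatures

Each stub's statement is the `Prop` `Sig.stub_<name>`; the registered obligation is
`theorem stub_<name> : Sig.stub_<name> := by sorry` (§2); the composition `LanfordEnvelopeR_of` takes the two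
signatures as hypotheses BY NAME. -/

/-- **S1 — the crude all-time envelope (energy conservation + Liouville + Tonelli; size M, provable now).** For every
reduced diameter `σ > 0` and constants `β₀ > 0`, `C₀ ≥ 0`: the time-zero envelope `(β₀, C₀)` implies, for some
`K ≥ 1`, `C ≥ 0`, the crude envelope `(β₀, K, C)` at ALL times (same Gaussian rate `β₀`: energy is conserved
exactly). Why true: order `s = N + 1` of the hypothesis is the a.e. pointwise bound `W_N ≤ C₀^{N+1} e^{-β₀E}` on
`D_ε` (`nthMarginal_self_apply`; `Φ_0 = id` on `good`, `vol(D ∖ good) = 0`); `E ∘ Φ_{-t} = E` on `good`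
(`IsHardSphereTrajectory.configEnergy_eq_holds`) and `Φ_{-t}` preserves `volume|_D`
(`HardSphereFlow.measurePreserving`), so the bound transports a.e.; Tonelli along `Fin.append` and
`∫ e^{-β₀|v|²/2} dx dv = (2π/β₀)^{3/2} =: I` give `K = max 1 (C₀ I)`, `C = C₀`; orders `s > N + 1` vanish. Leans on:
`nthMarginal_self_apply`, `nthMarginal_congr_ae`, `HardSphereFlow.{measurePreserving, measure_compl_good,
mapsTo_good, good_subset}`, `IsHardSphereTrajectory.configEnergy_eq_holds`, `marginal`/`appendMEquiv` Fubini. -/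
def Sig.stub_crudeEnvelope : Prop :=
  ∀ (a₀ θ₀ : T3 → ℝ) (u₀ : T3 → V3) (σ β₀ C₀ : ℝ), 0 < σ → 0 < β₀ → 0 ≤ C₀ →
    TimeZeroEnvelope σ a₀ u₀ θ₀ β₀ C₀ →
      ∃ K C : ℝ, 1 ≤ K ∧ 0 ≤ C ∧ CrudeEnvelope σ a₀ u₀ θ₀ β₀ K C

/-- **S2 — the core envelope without loss (THE HEART; size XL).** For continuous profiles `a₀, θ₀ > 0`, `u₀` there is
`σ₀' > 0` such that for `0 < σ < σ₀'`, whenever the evolved local Gibbs law has a time-zero envelope `(β₀, C₀)` and a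
crude all-time envelope `(β₀, K, C₁)` (`K ≥ 1`, `C₀, C₁ ≥ 0`), then for every horizon `T > 0` there are a core
fraction `1/m` and constants `β > 0`, `C` with the genuine, N-uniform envelope `|f^{(s)}(t)| ≤ C^s e^{-βE(Z_s)}` for
the core orders `m·s < N + 1` and all `t ∈ [0, T]`. Intended line: Lanford's short-time bound at fixed reduced
density (BBGKY Duhamel series, window `≍ (N+1)^{-1/3}` macroscopic time) iterated over `≍ T(N+1)^{1/3}` windows with the
constants RESTORED each window — pruning of super-exponential collision trees along the evolved law, tails paid by
the crude envelope, recollisions by the dilution `σ < σ₀'` (BGSS 2023-type bookkeeping out of equilibrium). Why it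
might fail = the crux's why-line: no N-uniform mechanism restoring the constants is known away from equilibrium;
collisional concentration of energy on few particles before `T` would break every fixed Gaussian envelope.
Leans on: `IsMildBBGKYSolutionOn.eq_sum_bbgkyDuhamelTerm`, `liouville_imp_bbgky`, the Lanford continuity
estimates of `BoltzmannHierarchySeries`, `Theorems.CollisionRate.stub_envelopeBound_const` (the equilibrium twin). -/
def Sig.stub_coreEnvelope : Prop :=
  ∀ (a₀ θ₀ : T3 → ℝ) (u₀ : T3 → V3), Continuous a₀ → Continuous θ₀ → Continuous u₀ →
    (∀ x, 0 < a₀ x) → (∀ x, 0 < θ₀ x) →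
    ∃ σ₀ : ℝ, 0 < σ₀ ∧ ∀ σ : ℝ, 0 < σ → σ < σ₀ →
      ∀ (β₀ C₀ K C₁ : ℝ), 0 < β₀ → 0 ≤ C₀ → 1 ≤ K → 0 ≤ C₁ →
        TimeZeroEnvelope σ a₀ u₀ θ₀ β₀ C₀ → CrudeEnvelope σ a₀ u₀ θ₀ β₀ K C₁ →
          ∀ T : ℝ, 0 < T → ∃ (m : ℕ) (β C : ℝ), 0 < β ∧ CoreEnvelopeOn σ a₀ u₀ θ₀ T m β C

/-! ## §2 Stubs (registered; `sorry` only inside them) — hardest: `stub_coreEnvelope` -/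

/-- **S1 (M, provable now).** The crude all-time envelope from the time-zero one. -/
theorem stub_crudeEnvelope : Sig.stub_crudeEnvelope := by
  sorry

/-- **S2 (XL; the heart).** The loss-free envelope on the core orders `m·s < N + 1`, `t ∈ [0, T]`. -/
theorem stub_coreEnvelope : Sig.stub_coreEnvelope := by
  sorry

/-! ## §3 Composition (sorry-free) -/

/-- The kinetic energy of a configuration is non-negative. -/
theorem configEnergy_nonneg' {s : ℕ} (Zs : Config s (Fin 3) T3) : 0 ≤ configEnergy Zs := by
  unfold configEnergy
  positivity

/-- Monotonicity of the Gaussian weight in the rate: `β ≤ β'` gives `e^{-β' E} ≤ e^{-β E}` since `E ≥ 0`. -/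
theorem exp_envelope_mono {s : ℕ} (Zs : Config s (Fin 3) T3) {β β' : ℝ} (h : β ≤ β') :
    Real.exp (-(β' * configEnergy Zs)) ≤ Real.exp (-(β * configEnergy Zs)) :=
  Real.exp_le_exp.2 (neg_le_neg (mul_le_mul_of_nonneg_right h (configEnergy_nonneg' Zs)))

/-- **The line closes the crux modulo its stubs**: `LanfordEnvelopeR` BY NAME from S1 and S2, the time-zero input
being the LANDED theorem `Theorems.CollisionRate.stub_lanfordEnvelopeR_initial`. Real content: the common dilution
threshold `min σ₀ᴱ⁰ σ₀'`; the chaining time-zero ⟶ crude (S1) ⟶ core (S2); and the merge of the two regimes under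
common constants `β := min β₀ β₂`, `C := max (K^m C₁) |C₂|` — on the bulk orders `N + 1 ≤ m·s` the exponential loss
of the crude envelope is absorbed into the order, `K^{N+1} ≤ K^{m s} = (K^m)^s`. -/
theorem LanfordEnvelopeR_of (h₁ : Sig.stub_crudeEnvelope) (h₂ : Sig.stub_coreEnvelope) :
    BGEndpointRigidity.LanfordEnvelopeR := by
  intro a₀ θ₀ u₀ ha hθ hu hap hθp
  -- time zero (landed) and the core stub each fix a dilution threshold from the profiles
  obtain ⟨σ₁, hσ₁, H₁⟩ :=
    Summit.AtomisticToContinuum.HydrodynamicLimit.Theorems.CollisionRate.stub_lanfordEnvelopeR_initial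
      a₀ θ₀ u₀ ha hθ hu hap hθp
  obtain ⟨σ₂, hσ₂, H₂⟩ := h₂ a₀ θ₀ u₀ ha hθ hu hap hθp
  refine ⟨min σ₁ σ₂, lt_min hσ₁ hσ₂, ?_⟩
  intro σ hσ hσlt T hT
  have hσ₁' : σ < σ₁ := lt_of_lt_of_le hσlt (min_le_left _ _)
  have hσ₂' : σ < σ₂ := lt_of_lt_of_le hσlt (min_le_right _ _)
  -- time-zero envelope `(β₀, C₀)` at this `σ`, in the crux's own format
  obtain ⟨β₀, C₀, hβ₀, hC₀, h0⟩ := H₁ σ hσ hσ₁'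
  have hT0 : TimeZeroEnvelope σ a₀ u₀ θ₀ β₀ C₀ := fun N Φ s => h0 N Φ s
  -- S1: the crude all-time envelope `(β₀, K, C₁)`
  obtain ⟨K, C₁, hK, hC₁, hcrude⟩ := h₁ a₀ θ₀ u₀ σ β₀ C₀ hσ hβ₀ hC₀ hT0
  -- S2: the core envelope on `[0, T]` with core fraction `1/m`
  obtain ⟨m, β₂, C₂, hβ₂, hcore⟩ := H₂ σ hσ hσ₂' β₀ C₀ K C₁ hβ₀ hC₀ hK hC₁ hT0 hcrude T hT
  -- common constants
  refine ⟨min β₀ β₂, max (K ^ m * C₁) |C₂|, lt_min hβ₀ hβ₂, ?_⟩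
  intro N Φ s t ht
  have hK0 : 0 ≤ K := zero_le_one.trans hK
  have hCmax0 : 0 ≤ max (K ^ m * C₁) |C₂| := le_max_of_le_right (abs_nonneg _)
  rcases Nat.lt_or_ge (m * s) (N + 1) with hs | hs
  · -- core orders: S2's envelope, weakened to the common constants
    filter_upwards [hcore N Φ s hs t ht] with Zs hZs
    refine hZs.trans ?_
    have hC : C₂ ^ s ≤ (max (K ^ m * C₁) |C₂|) ^ s :=
      (le_abs_self _).trans ((abs_pow C₂ s).symm ▸ pow_le_pow_left₀ (abs_nonneg _) (le_max_right _ _) s)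
    exact mul_le_mul hC (exp_envelope_mono Zs (min_le_right _ _)) (Real.exp_nonneg _) (pow_nonneg hCmax0 _)
  · -- bulk orders `N + 1 ≤ m·s`: the crude envelope, its loss `K^{N+1}` absorbed into `(K^m)^s`
    filter_upwards [hcrude N Φ s t] with Zs hZs
    refine hZs.trans ?_
    have hKpow : K ^ (N + 1) ≤ (K ^ m) ^ s := by
      rw [← pow_mul]
      exact pow_le_pow_right₀ hK hs
    have hC : K ^ (N + 1) * C₁ ^ s ≤ (max (K ^ m * C₁) |C₂|) ^ s :=
      calc K ^ (N + 1) * C₁ ^ s ≤ (K ^ m) ^ s * C₁ ^ s :=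
            mul_le_mul_of_nonneg_right hKpow (pow_nonneg hC₁ _)
        _ = (K ^ m * C₁) ^ s := (mul_pow _ _ _).symm
        _ ≤ (max (K ^ m * C₁) |C₂|) ^ s :=
            pow_le_pow_left₀ (mul_nonneg (pow_nonneg hK0 _) hC₁) (le_max_left _ _) s
    exact mul_le_mul hC (exp_envelope_mono Zs (min_le_left _ _)) (Real.exp_nonneg _) (pow_nonneg hCmax0 _)

/-- The skeleton instantiated: the crux modulo the two registered stubs. -/
theorem LanfordEnvelopeR_skeleton : BGEndpointRigidity.LanfordEnvelopeR :=
  LanfordEnvelopeR_of stub_crudeEnvelope stub_coreEnvelope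

end Summit.AtomisticToContinuum.HydrodynamicLimit.Cruxes.LanfordEnvelopeR.Birth

end
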